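import Summits.ResolutionOfSingularities.ResolutionOfSingularities.Theorems.EquisingularLiftEquisingularLiftNatTowerDefs
import HarnessLib

/-!
# Route `EquisingularLift`, crux EL♮ (stmt-ResolutionOfSingularities-20038) / EL♮(3) (stmt-…-20148) — rung TOWER ⊇ rung DIR₀:
# every `ReachDirZero` sub-chain is a `ReachTower` sub-chain (`reachTower_of_reachDirZero`)

res-L1-w45b-lead-2 g2 (lead). OURS; planning-vocabulary sanity theorem (pure logic over the downstairs predicates of …NatDirZeroDefs p527850 and
…NatTowerDefs p541504); NOT a statement of any manuscript; AI-written, weaker than expert review. `--supports stmt-ResolutionOfSingularities-20148 --as helper`.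

WHAT. (1) `exists_inCarrierReachK` — the rung-v7 inner point closure (4-ary stage predicate `(G, β, T, Z, b)`, text VERBATIM from the registered stubs)
reaches `(F₉, β₉, T₉, Z₉, b₉)` ⇒ for every initial cone shadow `K₂` SOME `K₉` is reached by the 5-ary closure `InCarrierReachK` (the shadow is carried
along; impredicative closure predicates compose by instantiating `R := ∃ K, InCarrierReachK … K b`). (2) `reachTower_of_reachDirZero` — a DIR₀ chain
(TC⁺ part + `DirStep` rounds: SECTIONS with `DirStepUnobs`) is a TOWER chain: `DirStepSec` (an isomorphism onto the carrier curve) gives `TowerFull`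
(finite, flat, surjective), the `DirStep` regularity clauses + `DirStepUnobs` are the left disjunct of `TowerRound`, and the cone shadow is carried as
`closure υ⁻¹(K ∖ centre)`. CONSEQUENCE for the skeleton (child v13 / parent v16): the TOWER rung's hypothesis is implied by the DIR₀ rung's, so the
residue `stub_elnat_three_isolated_nontower`'s clause `¬ DIR₀` is subsumed by `¬ TOWER` (kept for the record; harmless).
-/

set_option linter.dupNamespace false

noncomputable section

open CategoryTheory AlgebraicGeometry TopologicalSpace
open Literature.AlgebraicGeometry.Resolution (IsBlowup)

namespace Summit.ResolutionOfSingularities.ResolutionOfSingularities.Cruxes.EquisingularLiftNat.Sections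

/-- **The cone shadow can be carried along the rung-v7 inner closure**: if the 4-ary in-carrier point closure reaches `(F₉, β₉, T₉, Z₉, b₉)` from
`(F₂, 𝟙, T₂, Z₂, false)`, then for every `K₂` some `K₉` is reached by `InCarrierReachK`. [OURS · pure logic] -/
theorem exists_inCarrierReachK (F₂ : Scheme.{0}) (T₂ Z₂ K₂ : Set F₂) (F₉ : Scheme.{0}) (β₉ : F₉ ⟶ F₂) (T₉ Z₉ : Set F₉) (b₉ : Bool)
    (hinner : (∀ R : (∀ G : AlgebraicGeometry.Scheme.{0}, (G ⟶ F₂) → Set G → Set G → Bool → Prop), R F₂ (CategoryTheory.CategoryStruct.id F₂) T₂ Z₂ false → (∀ (G₁ G₂ : AlgebraicGeometry.Scheme.{0}) (β : G₁ ⟶ F₂) (T Z : Set G₁) (b : Bool) (y : ↥((AlgebraicGeometry.Scheme.IdealSheafData.vanishingIdeal (⟨closure Z, isClosed_closure⟩ : TopologicalSpace.Closeds G₁))).subscheme) (υ₁ : G₂ ⟶ G₁) (hy : IsClosed ({(((AlgebraicGeometry.Scheme.IdealSheafData.vanishingIdeal (⟨closure Z, isClosed_closure⟩ : TopologicalSpace.Closeds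 G₁))).subschemeι y : G₁)} : Set G₁)), R G₁ β T Z b → (((AlgebraicGeometry.Scheme.IdealSheafData.vanishingIdeal (⟨closure Z, isClosed_closure⟩ : TopologicalSpace.Closeds G₁))).subschemeι y : G₁) ∈ T → IsRegularLocalRing (((AlgebraicGeometry.Scheme.IdealSheafData.vanishingIdeal (⟨closure Z, isClosed_closure⟩ : TopologicalSpace.Closeds G₁))).subscheme.presheaf.stalk y) → IsRegularLocalRing (G₁.presheaf.stalk (((AlgebraicGeometry.Scheme.IdealSheafData.vanishingIdeal (⟨closure Z, isClosed_closure⟩ : TopologicalSpace.Closeds G₁))).subschemeι y : G₁)) → Literature.AlgebraicGeometry.Resolution.IsBlowup υ₁ (AlgebraicGeometry.Scheme.IdealSheafData.vanishingIdeal (⟨{(((AlgebraicGeometry.Scheme.IdealSheafData.vanishingIdeal (⟨closure Z, isClosed_closure⟩ : TopologicalSpace.Closeds G₁))).subschemeι y : G₁)}, hy⟩ : TopologicalSpace.Closeds G₁)) → R G₂ (CategoryTheory.CategoryStruct.comp υ₁ β) (closure (υ₁ ⁻¹' (T \ {(((AlgebraicGeometry.Scheme.IdealSheafData.vanishingIdeal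 (⟨closure Z, isClosed_closure⟩ : TopologicalSpace.Closeds G₁))).subschemeι y : G₁)}))) (closure (υ₁ ⁻¹' (Z \ {(((AlgebraicGeometry.Scheme.IdealSheafData.vanishingIdeal (⟨closure Z, isClosed_closure⟩ : TopologicalSpace.Closeds G₁))).subschemeι y : G₁)}))) b) → (∀ (G₁ G₂ : AlgebraicGeometry.Scheme.{0}) (β : G₁ ⟶ F₂) (T Z : Set G₁) (y : ↥((AlgebraicGeometry.Scheme.IdealSheafData.vanishingIdeal (⟨closure Z, isClosed_closure⟩ : TopologicalSpace.Closeds G₁))).subscheme) (υ₁ : G₂ ⟶ G₁) (hy : IsClosed ({(((AlgebraicGeometry.Scheme.IdealSheafData.vanishingIdeal (⟨closure Z, isClosed_closure⟩ : TopologicalSpace.Closeds G₁))).subschemeι y : G₁)} : Set G₁)), R G₁ β T Z false → (((AlgebraicGeometry.Scheme.IdealSheafData.vanishingIdeal (⟨closure Z, isClosed_closure⟩ : TopologicalSpace.Closeds G₁))).subschemeι y : G₁) ∈ T → ¬ IsRegularLocalRing (((AlgebraicGeometry.Scheme.IdealSheafData.vanishingIdeal (⟨closure Z, isClosed_closure⟩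 : TopologicalSpace.Closeds G₁))).subscheme.presheaf.stalk y) → IsRegularLocalRing (G₁.presheaf.stalk (((AlgebraicGeometry.Scheme.IdealSheafData.vanishingIdeal (⟨closure Z, isClosed_closure⟩ : TopologicalSpace.Closeds G₁))).subschemeι y : G₁)) → Literature.AlgebraicGeometry.Resolution.IsBlowup υ₁ (AlgebraicGeometry.Scheme.IdealSheafData.vanishingIdeal (⟨{(((AlgebraicGeometry.Scheme.IdealSheafData.vanishingIdeal (⟨closure Z, isClosed_closure⟩ : TopologicalSpace.Closeds G₁))).subschemeι y : G₁)}, hy⟩ : TopologicalSpace.Closeds G₁)) → R G₂ (CategoryTheory.CategoryStruct.comp υ₁ β) (closure (υ₁ ⁻¹' (T \ {(((AlgebraicGeometry.Scheme.IdealSheafData.vanishingIdeal (⟨closure Z, isClosed_closure⟩ : TopologicalSpace.Closeds G₁))).subschemeι y : G₁)}))) (closure (υ₁ ⁻¹' (Z \ {(((AlgebraicGeometry.Scheme.IdealSheafData.vanishingIdeal (⟨closure Z, isClosed_closure⟩ : TopologicalSpace.Closeds G₁))).subschemeι y : G₁)}))) true) → R F₉ β₉ T₉ Z₉ b₉)) 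:
    ∃ K₉ : Set F₉, InCarrierReachK F₂ T₂ Z₂ K₂ F₉ β₉ T₉ Z₉ K₉ b₉ := by
  -- run the 4-ary closure on `R G β T Z b := ∃ K, InCarrierReachK F₂ T₂ Z₂ K₂ G β T Z K b`
  refine hinner (fun G β T Z b => ∃ K : Set G, InCarrierReachK F₂ T₂ Z₂ K₂ G β T Z K b) ?_ ?_ ?_
  · exact ⟨K₂, fun R hseed _ _ => hseed⟩
  · intro G₁ G₂ β T Z b y υ₁ hy ⟨K, hK⟩ hyT hyreg hGreg hυ₁
    exact ⟨closure (υ₁ ⁻¹' (K \ {curvePt G₁ Z y})), fun R hseed hreg hsing =>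
      hreg G₁ G₂ β T Z K b y υ₁ hy (hK R hseed hreg hsing) hyT hyreg hGreg hυ₁⟩
  · intro G₁ G₂ β T Z y υ₁ hy ⟨K, hK⟩ hyT hysing hGreg hυ₁
    exact ⟨closure (υ₁ ⁻¹' (K \ {curvePt G₁ Z y})), fun R hseed hreg hsing =>
      hsing G₁ G₂ β T Z K y υ₁ hy (hK R hseed hreg hsing) hyT hysing hGreg hυ₁⟩

/-- **A `DirStep` round is a `TowerRound`** (left disjunct): the `DirStep`-closure of a 4-ary stage predicate transports to the closure of the
5-ary tower predicates, carrying the cone shadow. Stated as: if `R₁` (5-ary) is closed under `TowerRound`, then `∃ K, R₁ … K` (4-ary) is closed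
under `DirStep`. [OURS · pure logic + «an isomorphism is finite, flat and surjective»] -/
theorem dirStep_exists_of_towerRound (F₉ F₁₀ : Scheme.{0}) (υ' : F₁₀ ⟶ F₉) (Z₉ : Set F₉) (hZ₉ : IsClosed Z₉)
    (R₁ : ∀ G : Scheme.{0}, (G ⟶ F₁₀) → Set G → Set G → Set G → Prop) (hround : TowerRound F₉ F₁₀ υ' Z₉ hZ₉ R₁) :
    DirStep F₉ F₁₀ υ' Z₉ hZ₉ (fun G γ T E => ∃ K : Set G, R₁ G γ T E K) := by
  intro G G' γ T E hE Γ hΓ υ₂ ⟨K, hK⟩ hΓET hΓirr hsec hGreg hEreg hunobs hυ₂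
  have hfull : TowerFull F₉ F₁₀ υ' Z₉ hZ₉ G γ Γ hΓ := by
    obtain ⟨δ, hδ, hiso⟩ := hsec
    exact ⟨δ, hδ, inferInstance, inferInstance, δ.surjective⟩
  have h := hround G G' γ T E K hE Γ hΓ υ₂ hK hΓET hΓirr.nonempty hfull (Or.inl ⟨hGreg, hEreg, hunobs⟩) hυ₂
  exact ⟨⟨_, h.1⟩, ⟨_, h.2⟩⟩

/-- **Rung TOWER ⊇ rung DIR₀**: every `ReachDirZero` sub-chain is a `ReachTower` sub-chain. [OURS · pure logic] -/
theorem reachTower_of_reachDirZero (F₁ F₂ : Scheme.{0}) (υ : F₂ ⟶ F₁) (x : F₁) (T₂ : Set F₂) (F' : Scheme.{0}) (β : F' ⟶ F₂)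
    (T' : Set F') (h : ReachDirZero F₁ F₂ υ x T₂ F' β T') : ReachTower F₁ F₂ υ x T₂ F' β T' := by
  obtain ⟨W, F₉, β₉, T₉, Z₉, b₉, hZ₉, F₁₀, υ', γ', E', ⟨hxW, hnot, hWpr, hZT, hinner, hZ₉T₉, hT₉Z₉, hfin, hυ'⟩, hdir, hβ⟩ := h
  -- carry the cone shadow `St W` through the inner chain
  obtain ⟨K₉, hK₉⟩ := exists_inCarrierReachK F₂ T₂ (υ ⁻¹' {x} ∩ closure (υ ⁻¹' (W \ {x}))) (closure (υ ⁻¹' (W \ {x})))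
    F₉ β₉ T₉ Z₉ b₉ hinner
  -- carry it through the rounds: run the `DirStep`-closure on `R₁' G γ T E := ∃ K, ReachT G γ T E K`
  let ReachT : ∀ G : Scheme.{0}, (G ⟶ F₁₀) → Set G → Set G → Set G → Prop := fun G γ T E K =>
    ∀ R₁ : (∀ G : Scheme.{0}, (G ⟶ F₁₀) → Set G → Set G → Set G → Prop),
      R₁ F₁₀ (𝟙 F₁₀) (closure (υ' ⁻¹' (T₉ \ Z₉))) (υ' ⁻¹' Z₉) (closure (υ' ⁻¹' (K₉ \ Z₉))) →
      TowerPtReg F₁₀ R₁ → TowerPtRam F₁₀ R₁ → TowerRound F₉ F₁₀ υ' Z₉ hZ₉ R₁ → R₁ G γ T E K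
  have hreach : ∃ K' : Set F', ReachT F' γ' T' E' K' := by
    refine hdir (fun G γ T E => ∃ K : Set G, ReachT G γ T E K) ⟨closure (υ' ⁻¹' (K₉ \ Z₉)), fun R₁ hseed _ _ _ => hseed⟩ ?_
    -- `DirStep`-closure of `∃ K, ReachT … K`
    intro G G'' γ T E hE Γ hΓ υ₂ ⟨K, hK⟩ hΓET hΓirr hsec hGreg hEreg hunobs hυ₂
    have hstep : ∀ R₁ : (∀ G : Scheme.{0}, (G ⟶ F₁₀) → Set G → Set G → Set G → Prop),
        R₁ F₁₀ (𝟙 F₁₀) (closure (υ' ⁻¹' (T₉ \ Z₉))) (υ' ⁻¹' Z₉) (closure (υ' ⁻¹' (K₉ \ Z₉))) →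
        TowerPtReg F₁₀ R₁ → TowerPtRam F₁₀ R₁ → TowerRound F₉ F₁₀ υ' Z₉ hZ₉ R₁ →
        R₁ G'' (υ₂ ≫ γ) (closure (υ₂ ⁻¹' (T \ Γ))) (υ₂ ⁻¹' Γ) (closure (υ₂ ⁻¹' (K \ Γ))) ∧
          R₁ G'' (υ₂ ≫ γ) (closure (υ₂ ⁻¹' (T \ Γ))) (closure (υ₂ ⁻¹' (E \ Γ))) (closure (υ₂ ⁻¹' (K \ Γ))) := by
      intro R₁ hseed hreg hram hround
      have hfull : TowerFull F₉ F₁₀ υ' Z₉ hZ₉ G γ Γ hΓ := by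
        obtain ⟨δ, hδ, hiso⟩ := hsec
        exact ⟨δ, hδ, inferInstance, inferInstance, δ.surjective⟩
      exact hround G G'' γ T E K hE Γ hΓ υ₂ (hK R₁ hseed hreg hram hround) hΓET hΓirr.nonempty hfull
        (Or.inl ⟨hGreg, hEreg, hunobs⟩) hυ₂
    exact ⟨⟨closure (υ₂ ⁻¹' (K \ Γ)), fun R₁ hseed hreg hram hround => (hstep R₁ hseed hreg hram hround).1⟩,
      ⟨closure (υ₂ ⁻¹' (K \ Γ)), fun R₁ hseed hreg hram hround => (hstep R₁ hseed hreg hram hround).2⟩⟩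
  obtain ⟨K', hK'⟩ := hreach
  exact ⟨W, F₉, β₉, T₉, Z₉, K₉, b₉, hZ₉, F₁₀, υ', γ', E', K', hxW, hnot, hWpr, hZT, hK₉, hZ₉T₉, hT₉Z₉, hfin, hυ', hK', hβ⟩

end Summit.ResolutionOfSingularities.ResolutionOfSingularities.Cruxes.EquisingularLiftNat.Sections

end
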